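import Mathlib
import HarnessLib
import Summits.Ventures.LatticeQCDFlow.Exactness.GaugeFieldLocality

/-!
# Light cones on the torus for layers of ANY receptive radius: `K` layers that are `n`-local make an `nK`-local member, a change off the `s`-ball stays off the `(s+nK)`-ball, and the running density satisfies the cross identity on balls of radius `s + 2nK + e`

HONEST FRAMING: exact (Metropolis-corrected) sampling algorithms for lattice gauge theory;
figures of merit are autocorrelation/cost numbers at stated couplings and volumes; no
continuum-physics claim.

Venture `LatticeQCDFlow` (cell pub-lqcd), topic `Exactness`; FANOUT row 14 (`eng-flowhmc`, engine
`latflow.fthmc`, family B, on the periodic torus `Site d L = (Fin d → ZMod L)`).  NEW WORK of the cell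
over the tree (`GaugeFieldLocality`: the `n = 1` case — `foldr_local`, `agree_of_off`, `local_off`,
`foldr_off`, `foldr_logDet_cross` — and the vocabulary `near_*`); nothing is cited as a fact; no
number.  Written for the GEN-16 programme (VOLUME-UNIFORMITY for the LEARNED residual members): the
engine's conditioner (`maps.residual_context_flat` + a CNN of kernel 3 and depth `m`,
`flows_jax.nn.cnn_apply`) reads frozen plaquettes within sup-distance `m` of the link, so a learned
residual layer is `(m+1)`-LOCAL, not one-local; this file supplies the light-cone bookkeeping for
layers of a common receptive radius `n ≥ 0` (the `n = 1` statements of `GaugeFieldLocality` are the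
special case, not re-proved here).

## Vocabulary (all VERBATIM as in `GaugeFieldLocality`, no definition is introduced)

* `y` is `r`-NEAR `x`:  `∃ z : Fin d → ℤ, (∀ i, |z i| ≤ r) ∧ y = x + (i ↦ (z i : ZMod L))`;
* `V`, `W` AGREE on the `r`-ball at `x`; `V'` is `V` OFF the `s`-ball at `x`;
* a map `f` of fields is `n`-LOCAL:  agreement on the `(r+n)`-ball at `x` ⇒ agreement of the images on
  the `r`-ball at `x` (every `x`, `r`);
* a density `J` satisfies the `n`-CROSS IDENTITY:  for `s + 2n ≤ r`, if `A', B'` agree on the `r`-ball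
  at `x₀`, `A, B` agree there too, and `A'` is `A` off the `s`-ball, `B'` is `B` off the `s`-ball, then
  `J A' · J B = J A · J B'`.

## Content (any link type `G`)

* **`foldr_local_radius`** — `K` layers, each `n`-local: agreement on the `(r + nK)`-ball gives agreement
  of `F_K ∘ ⋯ ∘ F_1` on the `r`-ball;
* `agree_of_off_radius`, `local_off_radius`, **`foldr_off_radius`** — a change off the `s`-ball stays
  off the `(s + nK)`-ball;
* **`foldr_logDet_cross_radius`** — `n`-local layers whose densities satisfy the `n`-cross identity: the
  running density `J_1(v)·J_2(F_1 v)⋯` satisfies `J(A')·J(B) = J(A)·J(B')` when the balls have radius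
  `s + 2nK + e`.

NOT CLAIMED: layers of different radii in one member (take `n` = the largest); sharp cones; any number.
-/

noncomputable section

namespace Summit.Ventures.LatticeQCDFlow.Exactness

open Literature.MathematicalPhysics.QuantumFieldTheory

/-! ## Layers of receptive radius `n` -/

section Layers

variable {d L : ℕ} {G : Type*} [MeasurableSpace G] (n : ℕ)

/-- **A member of `K` `n`-local layers is `nK`-local**: if `V`, `W` agree on the `(r+nK)`-ball at `x`,
the composites `F_K ∘ ⋯ ∘ F_1` agree on the `r`-ball at `x`. -/
theorem foldr_local_radius (layers : List ((GaugeConfig d L G ≃ᵐ GaugeConfig d L G) × (GaugeConfig d L G → ℝ)))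
    (hloc : ∀ Ly ∈ layers, (∀ (U U' : GaugeConfig d L G) (x : Site d L) (r : ℕ),
      (∀ e : Edge d L, (∃ z : Fin d → ℤ, (∀ i, |z i| ≤ (((r+n) : ℕ) : ℤ)) ∧ e.1 = x + fun i => ((z i : ℤ) : ZMod L)) → U e = U' e) →
      (∀ e : Edge d L, (∃ z : Fin d → ℤ, (∀ i, |z i| ≤ ((r : ℕ) : ℤ)) ∧ e.1 = x + fun i => ((z i : ℤ) : ZMod L)) → (Ly.1 U) e = (Ly.1 U') e)))
    (r : ℕ) (U U' : GaugeConfig d L G) (x : Site d L)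
    (h : (∀ e : Edge d L, (∃ z : Fin d → ℤ, (∀ i, |z i| ≤ (((r+n*layers.length) : ℕ) : ℤ)) ∧ e.1 = x + fun i => ((z i : ℤ) : ZMod L)) → U e = U' e)) :
    (∀ e : Edge d L, (∃ z : Fin d → ℤ, (∀ i, |z i| ≤ ((r : ℕ) : ℤ)) ∧ e.1 = x + fun i => ((z i : ℤ) : ZMod L)) → ((layers.foldr (fun Ly (F : GaugeConfig d L G ≃ᵐ GaugeConfig d L G) => Ly.1.trans F) (MeasurableEquiv.refl (GaugeConfig d L G))) U) e = ((layers.foldr (fun Ly (F : GaugeConfig d L G ≃ᵐ GaugeConfig d L G) => Ly.1.trans F) (MeasurableEquiv.refl (GaugeConfig d L G))) U') e) := by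
  induction layers generalizing r U U' with
  | nil =>
    intro e he
    simp only [List.foldr_nil, MeasurableEquiv.refl_apply]
    exact h e (by simpa using he)
  | cons Ly rest ih =>
    intro e he
    simp only [List.foldr_cons, MeasurableEquiv.coe_trans, Function.comp_apply]
    have hr : r + n * (Ly :: rest).length = (r + n * rest.length) + n := by
      simp only [List.length_cons]; ring
    rw [hr] at h
    exact ih (fun L hL => hloc L (List.mem_cons_of_mem _ hL)) r (Ly.1 U) (Ly.1 U')
      (hloc Ly List.mem_cons_self U U' x (r + n * rest.length) h) e he

omit [MeasurableSpace G] in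
/-- A change off the `s`-ball at `x₀` is invisible on the `n`-ball around any site not `(s+n)`-near
`x₀`. -/
theorem agree_of_off_radius {A A' : GaugeConfig d L G} {x₀ : Site d L} {s : ℕ} (h : (∀ e : Edge d L, ¬ (∃ z : Fin d → ℤ, (∀ i, |z i| ≤ ((s : ℕ) : ℤ)) ∧ e.1 = x₀ + fun i => ((z i : ℤ) : ZMod L)) → A' e = A e))
    {y : Site d L} (hy : ¬ (∃ z : Fin d → ℤ, (∀ i, |z i| ≤ (((s+n) : ℕ) : ℤ)) ∧ y = x₀ + fun i => ((z i : ℤ) : ZMod L))) :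
    (∀ e : Edge d L, (∃ z : Fin d → ℤ, (∀ i, |z i| ≤ (((0+n) : ℕ) : ℤ)) ∧ e.1 = y + fun i => ((z i : ℤ) : ZMod L)) → A' e = A e) := by
  intro e he
  refine h e fun hn => hy ?_
  simpa using near_triangle hn (near_symm (near_mono (by omega) he))

omit [MeasurableSpace G] in
/-- **`n`-local maps push a change outward by `n`**: if `A'` is `A` off the `s`-ball, `f A'` is `f A`
off the `(s+n)`-ball. -/
theorem local_off_radius {f : GaugeConfig d L G → GaugeConfig d L G} (hf : (∀ (U U' : GaugeConfig d L G) (x : Site d L) (r : ℕ),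
      (∀ e : Edge d L, (∃ z : Fin d → ℤ, (∀ i, |z i| ≤ (((r+n) : ℕ) : ℤ)) ∧ e.1 = x + fun i => ((z i : ℤ) : ZMod L)) → U e = U' e) →
      (∀ e : Edge d L, (∃ z : Fin d → ℤ, (∀ i, |z i| ≤ ((r : ℕ) : ℤ)) ∧ e.1 = x + fun i => ((z i : ℤ) : ZMod L)) → (f U) e = (f U') e)))
    {A A' : GaugeConfig d L G} {x₀ : Site d L} {s : ℕ} (h : (∀ e : Edge d L, ¬ (∃ z : Fin d → ℤ, (∀ i, |z i| ≤ ((s : ℕ) : ℤ)) ∧ e.1 = x₀ + fun i => ((z i : ℤ) : ZMod L)) → A' e = A e)) :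
    (∀ e : Edge d L, ¬ (∃ z : Fin d → ℤ, (∀ i, |z i| ≤ (((s+n) : ℕ) : ℤ)) ∧ e.1 = x₀ + fun i => ((z i : ℤ) : ZMod L)) → (f A') e = (f A) e) := fun e he =>
  hf A' A e.1 0 (agree_of_off_radius n h he) e (near_refl e.1 0)

/-- **Members of `n`-local layers push a change outward by `nK`**. -/
theorem foldr_off_radius (layers : List ((GaugeConfig d L G ≃ᵐ GaugeConfig d L G) × (GaugeConfig d L G → ℝ)))
    (hloc : ∀ Ly ∈ layers, (∀ (U U' : GaugeConfig d L G) (x : Site d L) (r : ℕ),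
      (∀ e : Edge d L, (∃ z : Fin d → ℤ, (∀ i, |z i| ≤ (((r+n) : ℕ) : ℤ)) ∧ e.1 = x + fun i => ((z i : ℤ) : ZMod L)) → U e = U' e) →
      (∀ e : Edge d L, (∃ z : Fin d → ℤ, (∀ i, |z i| ≤ ((r : ℕ) : ℤ)) ∧ e.1 = x + fun i => ((z i : ℤ) : ZMod L)) → (Ly.1 U) e = (Ly.1 U') e)))
    {A A' : GaugeConfig d L G} {x₀ : Site d L} {s : ℕ} (h : (∀ e : Edge d L, ¬ (∃ z : Fin d → ℤ, (∀ i, |z i| ≤ ((s : ℕ) : ℤ)) ∧ e.1 = x₀ + fun i => ((z i : ℤ) : ZMod L)) → A' e = A e)) :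
    (∀ e : Edge d L, ¬ (∃ z : Fin d → ℤ, (∀ i, |z i| ≤ (((s+n*layers.length) : ℕ) : ℤ)) ∧ e.1 = x₀ + fun i => ((z i : ℤ) : ZMod L)) → ((layers.foldr (fun Ly (F : GaugeConfig d L G ≃ᵐ GaugeConfig d L G) => Ly.1.trans F) (MeasurableEquiv.refl (GaugeConfig d L G))) A') e = ((layers.foldr (fun Ly (F : GaugeConfig d L G ≃ᵐ GaugeConfig d L G) => Ly.1.trans F) (MeasurableEquiv.refl (GaugeConfig d L G))) A) e) := by
  induction layers generalizing s A A' with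
  | nil =>
    intro e he
    simp only [List.foldr_nil, MeasurableEquiv.refl_apply]
    exact h e (by simpa using he)
  | cons Ly rest ih =>
    intro e he
    simp only [List.foldr_cons, MeasurableEquiv.coe_trans, Function.comp_apply]
    have hs : s + n * (Ly :: rest).length = (s + n) + n * rest.length := by
      simp only [List.length_cons]; ring
    rw [hs] at he
    exact ih (fun L hL => hloc L (List.mem_cons_of_mem _ hL))
      (local_off_radius n (hloc Ly List.mem_cons_self) h) e he

/-- **THE CROSS IDENTITY FOR THE RUNNING DENSITY, receptive radius `n`.**  `n`-local layers whose
densities satisfy the `n`-cross identity: if `A', B'` agree on the `(s + 2nK + e₀)`-ball at `x₀`, `A, B`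
too, `A'` is `A` off the `s`-ball and `B'` is `B` off the `s`-ball, then `J(A')·J(B) = J(A)·J(B')` for
the running density `J(v) = J_1(v)·J_2(F_1 v)⋯` (each layer consumes `n` units of agreement and `n`
units of "off"). -/
theorem foldr_logDet_cross_radius (layers : List ((GaugeConfig d L G ≃ᵐ GaugeConfig d L G) × (GaugeConfig d L G → ℝ)))
    (hloc : ∀ Ly ∈ layers, (∀ (U U' : GaugeConfig d L G) (x : Site d L) (r : ℕ),
      (∀ e : Edge d L, (∃ z : Fin d → ℤ, (∀ i, |z i| ≤ (((r+n) : ℕ) : ℤ)) ∧ e.1 = x + fun i => ((z i : ℤ) : ZMod L)) → U e = U' e) →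
      (∀ e : Edge d L, (∃ z : Fin d → ℤ, (∀ i, |z i| ≤ ((r : ℕ) : ℤ)) ∧ e.1 = x + fun i => ((z i : ℤ) : ZMod L)) → (Ly.1 U) e = (Ly.1 U') e)))
    (hJ : ∀ Ly ∈ layers, (∀ (A A' B B' : GaugeConfig d L G) (x₀ : Site d L) (r s : ℕ), s + 2 * n ≤ r →
      (∀ e : Edge d L, (∃ z : Fin d → ℤ, (∀ i, |z i| ≤ ((r : ℕ) : ℤ)) ∧ e.1 = x₀ + fun i => ((z i : ℤ) : ZMod L)) → A' e = B' e) →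
      (∀ e : Edge d L, (∃ z : Fin d → ℤ, (∀ i, |z i| ≤ ((r : ℕ) : ℤ)) ∧ e.1 = x₀ + fun i => ((z i : ℤ) : ZMod L)) → A e = B e) →
      (∀ e : Edge d L, ¬ (∃ z : Fin d → ℤ, (∀ i, |z i| ≤ ((s : ℕ) : ℤ)) ∧ e.1 = x₀ + fun i => ((z i : ℤ) : ZMod L)) → A' e = A e) →
      (∀ e : Edge d L, ¬ (∃ z : Fin d → ℤ, (∀ i, |z i| ≤ ((s : ℕ) : ℤ)) ∧ e.1 = x₀ + fun i => ((z i : ℤ) : ZMod L)) → B' e = B e) → Ly.2 A' * Ly.2 B = Ly.2 A * Ly.2 B'))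
    (s e₀ : ℕ) (A A' B B' : GaugeConfig d L G) (x₀ : Site d L)
    (h1 : (∀ e : Edge d L, (∃ z : Fin d → ℤ, (∀ i, |z i| ≤ (((s+2*n*layers.length+e₀) : ℕ) : ℤ)) ∧ e.1 = x₀ + fun i => ((z i : ℤ) : ZMod L)) → A' e = B' e))
    (h2 : (∀ e : Edge d L, (∃ z : Fin d → ℤ, (∀ i, |z i| ≤ (((s+2*n*layers.length+e₀) : ℕ) : ℤ)) ∧ e.1 = x₀ + fun i => ((z i : ℤ) : ZMod L)) → A e = B e))
    (h3 : (∀ e : Edge d L, ¬ (∃ z : Fin d → ℤ, (∀ i, |z i| ≤ ((s : ℕ) : ℤ)) ∧ e.1 = x₀ + fun i => ((z i : ℤ) : ZMod L)) → A' e = A e)) (h4 : (∀ e : Edge d L, ¬ (∃ z : Fin d → ℤ, (∀ i, |z i| ≤ ((s : ℕ) : ℤ)) ∧ e.1 = x₀ + fun i => ((z i : ℤ) : ZMod L)) → B' e = B e)) :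
    (layers.foldr (fun Ly K => fun v => Ly.2 v * K (Ly.1 v)) (fun _ => (1 : ℝ))) A' * (layers.foldr (fun Ly K => fun v => Ly.2 v * K (Ly.1 v)) (fun _ => (1 : ℝ))) B = (layers.foldr (fun Ly K => fun v => Ly.2 v * K (Ly.1 v)) (fun _ => (1 : ℝ))) A * (layers.foldr (fun Ly K => fun v => Ly.2 v * K (Ly.1 v)) (fun _ => (1 : ℝ))) B' := by
  induction layers generalizing s A A' B B' with
  | nil => simp only [List.foldr_nil]
  | cons Ly rest ih =>
    simp only [List.foldr_cons]
    have hr : s + 2 * n * (Ly :: rest).length + e₀ = (s + 2 * n * rest.length + e₀ + n) + n := by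
      simp only [List.length_cons]; ring
    rw [hr] at h1 h2
    have hJ0 := hJ Ly List.mem_cons_self A A' B B' x₀ (s + 2 * n * rest.length + e₀ + n + n) s (by nlinarith) h1 h2 h3 h4
    have hA := hloc Ly List.mem_cons_self A' B' x₀ (s + 2 * n * rest.length + e₀ + n) h1
    have hB := hloc Ly List.mem_cons_self A B x₀ (s + 2 * n * rest.length + e₀ + n) h2
    have hr' : s + 2 * n * rest.length + e₀ + n = (s + n) + 2 * n * rest.length + e₀ := by ring
    rw [hr'] at hA hB
    have hrest := ih (fun L hL => hloc L (List.mem_cons_of_mem _ hL))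
      (fun L hL => hJ L (List.mem_cons_of_mem _ hL)) (s + n) (Ly.1 A) (Ly.1 A') (Ly.1 B) (Ly.1 B') hA hB
      (local_off_radius n (hloc Ly List.mem_cons_self) h3) (local_off_radius n (hloc Ly List.mem_cons_self) h4)
    rw [mul_mul_mul_comm, hJ0, hrest, mul_mul_mul_comm]

end Layers

/-! ## §2 (appended 2026-08-24, GEN-16) Layers of DIFFERENT receptive radii: the radii add up — closes the NOT-CLAIMED item "layers of different radii in one member" of the header above -/

section Radii

variable {d L : ℕ} {G : Type*} [MeasurableSpace G]

omit [MeasurableSpace G] in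
/-- An `n`-local map is `n'`-local for every `n' ≥ n`. -/
theorem localN_mono {f : GaugeConfig d L G → GaugeConfig d L G} {n n' : ℕ} (hn : n ≤ n')
    (hf : (∀ (U U' : GaugeConfig d L G) (x : Site d L) (r : ℕ),
      (∀ e : Edge d L, (∃ z : Fin d → ℤ, (∀ i, |z i| ≤ (((r+n) : ℕ) : ℤ)) ∧ e.1 = x + fun i => ((z i : ℤ) : ZMod L)) → U e = U' e) →
      (∀ e : Edge d L, (∃ z : Fin d → ℤ, (∀ i, |z i| ≤ ((r : ℕ) : ℤ)) ∧ e.1 = x + fun i => ((z i : ℤ) : ZMod L)) → (f U) e = (f U') e))) :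
    (∀ (U U' : GaugeConfig d L G) (x : Site d L) (r : ℕ),
      (∀ e : Edge d L, (∃ z : Fin d → ℤ, (∀ i, |z i| ≤ (((r+n') : ℕ) : ℤ)) ∧ e.1 = x + fun i => ((z i : ℤ) : ZMod L)) → U e = U' e) →
      (∀ e : Edge d L, (∃ z : Fin d → ℤ, (∀ i, |z i| ≤ ((r : ℕ) : ℤ)) ∧ e.1 = x + fun i => ((z i : ℤ) : ZMod L)) → (f U) e = (f U') e)) := fun U U' x r h =>
  hf U U' x r (fun e he => h e (near_mono (by omega) he))

omit [MeasurableSpace G] in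
/-- A density with the `n`-cross identity has the `n'`-cross identity for every `n' ≥ n`. -/
theorem crossN_mono {J : GaugeConfig d L G → ℝ} {n n' : ℕ} (hn : n ≤ n')
    (hJ : (∀ (A A' B B' : GaugeConfig d L G) (x₀ : Site d L) (r s : ℕ), s + 2 * n ≤ r →
      (∀ e : Edge d L, (∃ z : Fin d → ℤ, (∀ i, |z i| ≤ ((r : ℕ) : ℤ)) ∧ e.1 = x₀ + fun i => ((z i : ℤ) : ZMod L)) → A' e = B' e) →
      (∀ e : Edge d L, (∃ z : Fin d → ℤ, (∀ i, |z i| ≤ ((r : ℕ) : ℤ)) ∧ e.1 = x₀ + fun i => ((z i : ℤ) : ZMod L)) → A e = B e) →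
      (∀ e : Edge d L, ¬ (∃ z : Fin d → ℤ, (∀ i, |z i| ≤ ((s : ℕ) : ℤ)) ∧ e.1 = x₀ + fun i => ((z i : ℤ) : ZMod L)) → A' e = A e) →
      (∀ e : Edge d L, ¬ (∃ z : Fin d → ℤ, (∀ i, |z i| ≤ ((s : ℕ) : ℤ)) ∧ e.1 = x₀ + fun i => ((z i : ℤ) : ZMod L)) → B' e = B e) → J A' * J B = J A * J B')) :
    (∀ (A A' B B' : GaugeConfig d L G) (x₀ : Site d L) (r s : ℕ), s + 2 * n' ≤ r →
      (∀ e : Edge d L, (∃ z : Fin d → ℤ, (∀ i, |z i| ≤ ((r : ℕ) : ℤ)) ∧ e.1 = x₀ + fun i => ((z i : ℤ) : ZMod L)) → A' e = B' e) →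
      (∀ e : Edge d L, (∃ z : Fin d → ℤ, (∀ i, |z i| ≤ ((r : ℕ) : ℤ)) ∧ e.1 = x₀ + fun i => ((z i : ℤ) : ZMod L)) → A e = B e) →
      (∀ e : Edge d L, ¬ (∃ z : Fin d → ℤ, (∀ i, |z i| ≤ ((s : ℕ) : ℤ)) ∧ e.1 = x₀ + fun i => ((z i : ℤ) : ZMod L)) → A' e = A e) →
      (∀ e : Edge d L, ¬ (∃ z : Fin d → ℤ, (∀ i, |z i| ≤ ((s : ℕ) : ℤ)) ∧ e.1 = x₀ + fun i => ((z i : ℤ) : ZMod L)) → B' e = B e) → J A' * J B = J A * J B') :=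
  fun A A' B B' x₀ r s hrs h1 h2 h3 h4 => hJ A A' B B' x₀ r s (le_trans (by nlinarith) hrs) h1 h2 h3 h4

/-- **Members of layers with their OWN receptive radii `nf Ly`: the radii ADD UP** — if `V`, `W` agree on
the `(r + Σ nf)`-ball at `x`, the composites agree on the `r`-ball (so a member mixing a staple-local
layer with a depth-`m` CNN layer has light cone `1 + (m+1)`, not `2(m+1)`). -/
theorem foldr_local_radii (layers : List ((GaugeConfig d L G ≃ᵐ GaugeConfig d L G) × (GaugeConfig d L G → ℝ)))
    (nf : ((GaugeConfig d L G ≃ᵐ GaugeConfig d L G) × (GaugeConfig d L G → ℝ)) → ℕ)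
    (hloc : ∀ Ly ∈ layers, (∀ (U U' : GaugeConfig d L G) (x : Site d L) (r : ℕ),
      (∀ e : Edge d L, (∃ z : Fin d → ℤ, (∀ i, |z i| ≤ (((r+(nf Ly)) : ℕ) : ℤ)) ∧ e.1 = x + fun i => ((z i : ℤ) : ZMod L)) → U e = U' e) →
      (∀ e : Edge d L, (∃ z : Fin d → ℤ, (∀ i, |z i| ≤ ((r : ℕ) : ℤ)) ∧ e.1 = x + fun i => ((z i : ℤ) : ZMod L)) → (Ly.1 U) e = (Ly.1 U') e)))
    (r : ℕ) (U U' : GaugeConfig d L G) (x : Site d L)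
    (h : (∀ e : Edge d L, (∃ z : Fin d → ℤ, (∀ i, |z i| ≤ (((r+(layers.map nf).sum) : ℕ) : ℤ)) ∧ e.1 = x + fun i => ((z i : ℤ) : ZMod L)) → U e = U' e)) :
    (∀ e : Edge d L, (∃ z : Fin d → ℤ, (∀ i, |z i| ≤ ((r : ℕ) : ℤ)) ∧ e.1 = x + fun i => ((z i : ℤ) : ZMod L)) → ((layers.foldr (fun Ly (F : GaugeConfig d L G ≃ᵐ GaugeConfig d L G) => Ly.1.trans F) (MeasurableEquiv.refl (GaugeConfig d L G))) U) e = ((layers.foldr (fun Ly (F : GaugeConfig d L G ≃ᵐ GaugeConfig d L G) => Ly.1.trans F) (MeasurableEquiv.refl (GaugeConfig d L G))) U') e) := by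
  induction layers generalizing r U U' with
  | nil =>
    intro e he
    simp only [List.foldr_nil, MeasurableEquiv.refl_apply]
    exact h e (by simpa using he)
  | cons Ly rest ih =>
    intro e he
    simp only [List.foldr_cons, MeasurableEquiv.coe_trans, Function.comp_apply]
    have hr : r + ((Ly :: rest).map nf).sum = (r + (rest.map nf).sum) + nf Ly := by
      simp only [List.map_cons, List.sum_cons]; ring
    rw [hr] at h
    exact ih (fun L hL => hloc L (List.mem_cons_of_mem _ hL)) r (Ly.1 U) (Ly.1 U')
      (hloc Ly List.mem_cons_self U U' x (r + (rest.map nf).sum) h) e he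

/-- **A change off the `s`-ball stays off the `(s + Σ nf)`-ball** for layers with their own radii. -/
theorem foldr_off_radii (layers : List ((GaugeConfig d L G ≃ᵐ GaugeConfig d L G) × (GaugeConfig d L G → ℝ)))
    (nf : ((GaugeConfig d L G ≃ᵐ GaugeConfig d L G) × (GaugeConfig d L G → ℝ)) → ℕ)
    (hloc : ∀ Ly ∈ layers, (∀ (U U' : GaugeConfig d L G) (x : Site d L) (r : ℕ),
      (∀ e : Edge d L, (∃ z : Fin d → ℤ, (∀ i, |z i| ≤ (((r+(nf Ly)) : ℕ) : ℤ)) ∧ e.1 = x + fun i => ((z i : ℤ) : ZMod L)) → U e = U' e) →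
      (∀ e : Edge d L, (∃ z : Fin d → ℤ, (∀ i, |z i| ≤ ((r : ℕ) : ℤ)) ∧ e.1 = x + fun i => ((z i : ℤ) : ZMod L)) → (Ly.1 U) e = (Ly.1 U') e)))
    {A A' : GaugeConfig d L G} {x₀ : Site d L} {s : ℕ} (h : (∀ e : Edge d L, ¬ (∃ z : Fin d → ℤ, (∀ i, |z i| ≤ ((s : ℕ) : ℤ)) ∧ e.1 = x₀ + fun i => ((z i : ℤ) : ZMod L)) → A' e = A e)) :
    (∀ e : Edge d L, ¬ (∃ z : Fin d → ℤ, (∀ i, |z i| ≤ (((s+(layers.map nf).sum) : ℕ) : ℤ)) ∧ e.1 = x₀ + fun i => ((z i : ℤ) : ZMod L)) → ((layers.foldr (fun Ly (F : GaugeConfig d L G ≃ᵐ GaugeConfig d L G) => Ly.1.trans F) (MeasurableEquiv.refl (GaugeConfig d L G))) A') e = ((layers.foldr (fun Ly (F : GaugeConfig d L G ≃ᵐ GaugeConfig d L G) => Ly.1.trans F) (MeasurableEquiv.refl (GaugeConfig d L G))) A) e) := by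
  induction layers generalizing s A A' with
  | nil =>
    intro e he
    simp only [List.foldr_nil, MeasurableEquiv.refl_apply]
    exact h e (by simpa using he)
  | cons Ly rest ih =>
    intro e he
    simp only [List.foldr_cons, MeasurableEquiv.coe_trans, Function.comp_apply]
    have hs : s + ((Ly :: rest).map nf).sum = (s + nf Ly) + (rest.map nf).sum := by
      simp only [List.map_cons, List.sum_cons]; ring
    rw [hs] at he
    exact ih (fun L hL => hloc L (List.mem_cons_of_mem _ hL))
      (local_off_radius (nf Ly) (hloc Ly List.mem_cons_self) h) e he

end Radii

end Summit.Ventures.LatticeQCDFlow.Exactness
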